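import Mathlib
import Summits.ResolutionOfSingularities.ResolutionOfSingularities.Theorems.RadicialJungCleanModelsCleanProp44SuccessorCount
import Summits.ResolutionOfSingularities.ResolutionOfSingularities.Theorems.RadicialJungCleanModelsCleanProp44DescentAtBirth
import HarnessLib

/-!
# Route `RadicialJung`, crux `CleanModels` (stmt-ResolutionOfSingularities-15917), line `Sketch` rev 35, stub 6 `stub_cleanProp44` (X44c):
# THE `δ`-DESCENT OF ONE GENERATION IN ONE THEOREM — face data + the births on `Γ″` ⟹ `Σ (δ′ − 1)[κ(c′):κ] ≤ δ − 2` and `δ′ ≤ δ − 1` (recipe (3)+(5)+(6))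

Seat decomp-res-hand-2 g21 (structural hand).  ONE-STOP COMPOSITION of ✓ `exists_successor_of_solvableFace` (`…SuccessorCount`), ✓ `descent_at_birth` and
✓ `descent_le_sub_two` / `descent_lt` (`…DescentAtBirth`): memo 4e §2.5 «CONCLUSION (B′): along a chain of births `c ← c′ ← c″ ← ⋯` the values `δ*` drop by at
least `1` at each generation … (branching `≤ δ* − 2` per generation by the degree count)» and §2.6 (c) (every residue field, outside the corner `λ′ ≡ 0`), with
Hironaka's `δ*` replaced by the def-free surrogate of ✓ `…LeafOrderDivision` throughout.  INPUT = exactly what the scheme side (census (S)) must deliver for ONE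
generation: the face `Φ ∈ κ(c)[u][T]` of the old birth (✓ `tower_face`: `deg_T Φ ≤ μ`, constant top coefficient `c ≠ 0`, `deg_u Φ_0 ≤ μδ`), `p ∣ δ`, a curve
`π` of the last exceptional divisor along which the transform keeps order `μ` (`π` a non-unit, `π^μ ∣ Φ`), and for each new birth `c′_i ∈ Γ″` (closed point
`P_i` of the base line): the local ring `S_i` of the exceptional chart at `c′_i` (a `κ[u][T]`-algebra) with the curve ideal `I_i` of `K_i = L′_{rep,i} ∩ E`
(`S_i/I_i` a DVR of characteristic `p`) below the maximal `𝔪_i`, the new leaf on `E` (`v(c)·T − G_i^p ∈ I_i`), the new surrogate «`δ′_i ≥ d′_i`» read along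
`K_i` (`Φ ∈ I_i + 𝔪_i^{μ d′_i}`, ✓ `map_mem_sup_pow_of_le_leafSum_weight`), and the projection `K_i → 𝔸¹_u` unramified at `c′_i` with the same residue field
(dense modulo `𝔪̄_i^{d′_i}`, order-detecting at `P_i`):

* `birth_descent_of_face` — **THE DESCENT OF ONE GENERATION**: `π = a(T + λ)`, `Φ = c(T + λ)^μ`, `deg λ ≤ δ`, and if `λ′ ≠ 0` and `v(c) ≠ 0`:
  `Σ_i (d′_i − 1)·deg P_i ≤ δ − 2` and `d′_i ≤ δ − 1` for every birth.
* `birth_descent_of_face_perfect` — over a PERFECT `κ(c)` the dichotomy is complete: EITHER `λ′ ≠ 0` and the descent holds, OR the restricted unit `−v(c)·λ` is a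
  `p`-th power in `κ[u]` (then `Γ″` carries no obstruction point of finite birth order: no birth at all, ✓ `exists_eq_pow_of_restriction_of_derivative_eq_zero`).

Honest framing: OURS, composition only; census (S) (the instantiation) and (B5′) (imperfect `κ(c)`, `λ′ ≡ 0` with `−v(c)λ ∉ κ[u]^p`) remain; nothing here proves
X44c, any case of `CleanModels`, or resolution of singularities in characteristic `p`. [cite: CossartPiltant2008, Lemma 4.3 (4)–(5); Prop. 4.4 (proof, p. 11)]
[cite: CossartPiltant2009, ch.1 II.5.3.2 (i)] [cite: CossartJannsenSaito2020, Lemma 7.5, Def. 7.1]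
-/

noncomputable section

set_option linter.dupNamespace false -- mandated namespace of this single-conjunct summit

open Polynomial

namespace Summit.ResolutionOfSingularities.ResolutionOfSingularities.Theorems.RadicialJung.CleanModels

section OneGeneration

variable {k : Type*} [Field k] (p : ℕ) [Fact p.Prime] [CharP k p]
variable {ι : Type*} (s : Finset ι) (Si : ι → Type*) [∀ i, CommRing (Si i)] [∀ i, Algebra (k[X])[X] (Si i)]
  (I 𝔪 : ∀ i, Ideal (Si i)) [∀ i, (I i).IsPrime] [∀ i, IsDiscreteValuationRing (Si i ⧸ I i)] [∀ i, (𝔪 i).IsMaximal]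
  [∀ i, CharP (Si i ⧸ I i) p]

/-- **THE `δ`-DESCENT OF ONE GENERATION** (memo 4e §2.5 CONCLUSION (B′) / §2.6 (c), surrogate currency, def-free).  See the module docstring for the data.
[cite: CossartPiltant2008, Prop. 4.4 (proof, p. 11)] [cite: CossartPiltant2009, ch.1 II.5.3.2 (i)] -/
theorem birth_descent_of_face {Φ π : (k[X])[X]} {μ δ : ℕ} (hμ : 1 ≤ μ) (hdeg : Φ.natDegree ≤ μ) {c : k} (hc : c ≠ 0)
    (htop : Φ.coeff μ = C c) (hC0 : (Φ.coeff 0).natDegree ≤ μ * δ) (hδ : (δ : k) = 0) (hπ : ¬ IsUnit π) (hdvd : π ^ μ ∣ Φ)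
    (a₀ : k) (hI : ∀ i ∈ s, I i ≤ 𝔪 i) (Gi : ∀ i, Si i) (d' : ι → ℕ) (hd'1 : ∀ i ∈ s, 1 ≤ d' i)
    (hw : ∀ i ∈ s, algebraMap (k[X])[X] (Si i) (C (C a₀) * X) - Gi i ^ p ∈ I i)
    (hf : ∀ i ∈ s, algebraMap (k[X])[X] (Si i) Φ ∈ I i ⊔ 𝔪 i ^ (μ * d' i))
    (P : ι → k[X]) (hP : ∀ i ∈ s, Prime (P i)) (hne : ∀ i ∈ s, ∀ j ∈ s, i ≠ j → ¬ P i ∣ P j)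
    (hdense : ∀ i ∈ s, ∀ x : Si i ⧸ I i, ∃ g : k[X],
      x - ((Ideal.Quotient.mk (I i)).comp ((algebraMap (k[X])[X] (Si i)).comp C)) g ∈ ((𝔪 i).map (Ideal.Quotient.mk (I i))) ^ d' i)
    (hord : ∀ i ∈ s, ∀ h : k[X], ((Ideal.Quotient.mk (I i)).comp ((algebraMap (k[X])[X] (Si i)).comp C)) h ∈
      ((𝔪 i).map (Ideal.Quotient.mk (I i))) ^ d' i → h ∈ Ideal.span {P i} ^ d' i) :
    ∃ (a : k) (lam : k[X]), a ≠ 0 ∧ π = C (C a) * (X + C lam) ∧ Φ = C (C c) * (X + C lam) ^ μ ∧ lam.natDegree ≤ δ ∧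
      (derivative lam ≠ 0 → a₀ ≠ 0 →
        (∑ i ∈ s, (d' i - 1) * (P i).natDegree ≤ δ - 2) ∧ ∀ i ∈ s, d' i ≤ δ - 1) := by
  obtain ⟨a, lam, ha, hπeq, hΦ, hlam, -⟩ := exists_successor_of_solvableFace hμ hdeg hc htop hπ hdvd hC0 hδ
  refine ⟨a, lam, ha, hπeq, hΦ, hlam, fun hlam' ha₀ => ?_⟩
  -- at each birth: `(−a₀)λ·1^p + (−g_i)^p ∈ (P_i)^{d′_i}`
  have hbirth : ∀ i ∈ s, ∃ g : k[X], C (-a₀) * lam * 1 ^ p + (-g) ^ p ∈ Ideal.span {P i} ^ d' i := by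
    intro i hi
    have hf' : algebraMap (k[X])[X] (Si i) (C (C c) * (X + C lam) ^ μ) ∈ I i ⊔ 𝔪 i ^ (μ * d' i) := by
      rw [← hΦ]; exact hf i hi
    exact descent_at_birth (I i) (𝔪 i) (hI i hi) p hc a₀ lam (by omega) (hw i hi) hf' (hdense i hi) (hord i hi)
  choose! g hg using hbirth
  have ha₀' : -a₀ ≠ 0 := neg_ne_zero.mpr ha₀
  exact ⟨descent_le_sub_two p ha₀' hlam hδ hlam' s P g d' hP hne hd'1 hg,
    descent_lt p ha₀' hlam hδ hlam' s P g d' hP hne hd'1 hg⟩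

/-- **Over a perfect residue field the dichotomy is complete** (memo 4e §2.5: births occur only out of p-prepared faces, where `λ′ ≢ 0`; a non-prepared face has
`λ ∈ κ[u]^p` and its successor is `W`-invariant — NO birth): with the data of `birth_descent_of_face` and `κ` perfect, EITHER the descent inequalities hold, OR
the restricted unit `(−v(c))·λ` is a `p`-th power `H^p` in `κ[u]` (so `(−v(c))λ·1^p + (−H)^p ∈ 𝔞^n` for every ideal `𝔞` and every `n`: no point of `Γ″` has finite
birth order). [cite: CossartPiltant2008, Prop. 4.4 (proof, p. 11)] -/
theorem birth_descent_of_face_perfect [PerfectRing k p] {Φ π : (k[X])[X]} {μ δ : ℕ} (hμ : 1 ≤ μ) (hdeg : Φ.natDegree ≤ μ)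
    {c : k} (hc : c ≠ 0) (htop : Φ.coeff μ = C c) (hC0 : (Φ.coeff 0).natDegree ≤ μ * δ) (hδ : (δ : k) = 0) (hπ : ¬ IsUnit π)
    (hdvd : π ^ μ ∣ Φ) {a₀ : k} (ha₀ : a₀ ≠ 0) (hI : ∀ i ∈ s, I i ≤ 𝔪 i) (Gi : ∀ i, Si i) (d' : ι → ℕ)
    (hd'1 : ∀ i ∈ s, 1 ≤ d' i)
    (hw : ∀ i ∈ s, algebraMap (k[X])[X] (Si i) (C (C a₀) * X) - Gi i ^ p ∈ I i)
    (hf : ∀ i ∈ s, algebraMap (k[X])[X] (Si i) Φ ∈ I i ⊔ 𝔪 i ^ (μ * d' i))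
    (P : ι → k[X]) (hP : ∀ i ∈ s, Prime (P i)) (hne : ∀ i ∈ s, ∀ j ∈ s, i ≠ j → ¬ P i ∣ P j)
    (hdense : ∀ i ∈ s, ∀ x : Si i ⧸ I i, ∃ g : k[X],
      x - ((Ideal.Quotient.mk (I i)).comp ((algebraMap (k[X])[X] (Si i)).comp C)) g ∈ ((𝔪 i).map (Ideal.Quotient.mk (I i))) ^ d' i)
    (hord : ∀ i ∈ s, ∀ h : k[X], ((Ideal.Quotient.mk (I i)).comp ((algebraMap (k[X])[X] (Si i)).comp C)) h ∈
      ((𝔪 i).map (Ideal.Quotient.mk (I i))) ^ d' i → h ∈ Ideal.span {P i} ^ d' i) :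
    ∃ (a : k) (lam : k[X]), a ≠ 0 ∧ π = C (C a) * (X + C lam) ∧ Φ = C (C c) * (X + C lam) ^ μ ∧ lam.natDegree ≤ δ ∧
      (((∑ i ∈ s, (d' i - 1) * (P i).natDegree ≤ δ - 2) ∧ ∀ i ∈ s, d' i ≤ δ - 1) ∨
        ∃ H : k[X], C (-a₀) * lam = H ^ p ∧ ∀ (𝔞 : Ideal k[X]) (n : ℕ), C (-a₀) * lam * 1 ^ p + (-H) ^ p ∈ 𝔞 ^ n) := by
  obtain ⟨a, lam, ha, hπeq, hΦ, hlam, hdesc⟩ :=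
    birth_descent_of_face p s Si I 𝔪 hμ hdeg hc htop hC0 hδ hπ hdvd a₀ hI Gi d' hd'1 hw hf P hP hne hdense hord
  refine ⟨a, lam, ha, hπeq, hΦ, hlam, ?_⟩
  by_cases hlam' : derivative lam = 0
  · right
    obtain ⟨H, hH, hmem⟩ := exists_eq_pow_of_restriction_of_derivative_eq_zero p (RingHom.id k[X]) (U := C (-a₀) * lam)
      (a₀ := -a₀) (lam := lam) rfl hlam'
    exact ⟨H, hH, hmem⟩
  · exact Or.inl (hdesc hlam' ha₀)

end OneGeneration

end Summit.ResolutionOfSingularities.ResolutionOfSingularities.Theorems.RadicialJung.CleanModels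

end
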